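import Mathlib
import HarnessLib
import HarnessLib.Audit
import Summits.Schanuel.Statement
import HarnessLib.Audit.Status.Attr

/-!
Route: SurplusLinkage

# Route SurplusLinkage — Schanuel = surplus a+b ≥ n ∧ height-free Baker over L = ℚ(e^z)^alg ∧ no
nonlinear excess linkage (residual)

For a ℚ-linearly independent z : Fin n → ℂ write a = trdeg ℚ(z), b = trdeg ℚ(e^z), c = trdeg ℚ(z,
e^z) (the Statement's field),
L = ℚ(e^z)^alg ∩ ℂ and d = dim_L span_L(1, z₁, …, zₙ). Schanuel (c ≥ n) is cut into three conjuncts,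
each a consequence of S:
X = SurplusNonneg ∧ BakerOverL ∧ NonlinearLinkage. SurplusNonneg: a + b ≥ n (the common hull of
Lindemann–Weierstrass, a-side
algebraic, and algebraic independence of logarithms, b-side algebraic). BakerOverL (deciding,
attacked): d + b ≥ n + 1, i.e. at most b
independent L-AFFINE relations among 1, z₁, …, zₙ — Baker's inhomogeneous theorem with the
coefficient field ℚ̄ replaced by L and NO
Diophantine hypothesis on L; its b = 0 layer IS Baker's theorem (proved in tree). NonlinearLinkage
(declared RESIDUAL): at a tuple where
both hold, c ≥ n — "a first failure of Schanuel with non-negative surplus is never purely L-affine".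
Typed from the merged sketches
surplus-linkage-split + baker-over-exponential-field (markdown wave, reader PASS ×2); no idea card
is realised.
Lean: `Summit.Schanuel.Schanuel.Theses.SurplusLinkage.SurplusNonneg ∧
Summit.Schanuel.Schanuel.Theses.SurplusLinkage.BakerOverL ∧
Summit.Schanuel.Schanuel.Theses.SurplusLinkage.NonlinearLinkage`

## Assembly
Pure logic (Sketch.lean / glue.lean `closes`, rc 0): given ℚ-independent z, SurplusNonneg and
BakerOverL supply the two hypotheses of
NonlinearLinkage at z, whose conclusion is the Statement's inequality; `closes h₁ h₂ h₃ := fun n z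
hz => h₃ n z hz (h₁ n z hz) (h₂ n z hz)`.
All three binders are load-bearing; conversely S ⇒ each conjunct (c ≤ a + b; c ≤ (n + 1 − d) + b by
the tower law; trivially), so
X ⟺ S with NonlinearLinkage the named residual.

Rationale: WHY THIS LINE. The classical invariants (a, b, c) of a tuple and the L-affine rank d have never been
used as the CUT of Schanuel: every printed partial
result is a rung of exactly one conjunct — LW / Hermite–Lindemann / Gel'fond–Schneider / Diaz
(NesterenkoPhilippon2001 Ch. 13–14, Diaz1989)
live in SurplusNonneg, Baker's theorem (Baker1975 Thm 2.1) and Baker's method over coefficient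
fields of finite transcendence type
(Chudnovsky1984 Ch. 2 Thm 1.1; NesterenkoPhilippon2001 Ch. 14 Conj. 2.5 "intermediate situations …
compared with Baker's method") live in
BakerOverL — so the split assigns each conjunct to the method family that owns it and isolates what
neither family touches (nonlinear
algebraic linkage between ℚ(z) and ℚ(e^z) at non-negative surplus, empty for n ≤ 2 and for b = 0) as
an explicit, typed residual.
Imported: transcendence methods only (Baker; Gel'fond–Schneider–Philippon); the new ingredient is
the coefficient field L = ℚ(e^z)^alg
generated by the tuple itself, height-free. What no listed route does:
DiophantineCore.BakerOnExpAlgebraic is a Diophantine MEASURE on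
Kirby's core, ToricSector/CoprimeExpPolynomials grade by ℤ- /ℚ̄-linear relations in (z, e^z),
RecursiveCore's linear shadow is ℚ-affine;
none uses L-affine rank or the surplus a + b − n (reader verdicts, both sketches).

RANKED CRUXES. #2 BakerOverL (crux) — for ℚ-linearly independent z : Fin n → ℂ, dim_L span_L(1, z₁,
…, zₙ) + trdeg ℚ(e^z) ≥ n + 1 with L = (algebraic closure of ℚ(e^z) in ℂ): the independent L-affine
relations among 1, z₁, …, zₙ number at most b (sketch baker-over-exponential-field X1; b = 0 layer =
Baker's inhomogeneous theorem). [difficulty: open-problem] (why it might fail: for b ≥ 1 Baker's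
method needs heights on the coefficient field; every printed extension (Chudnovsky1984 Ch.2,
Waldschmidt transcendence type) assumes a transcendence MEASURE on L — height-free it may simply be
Schanuel-hard at (e, π)-type tuples.) [Baker1975, Chudnovsky1984, NesterenkoPhilippon2001,
Waldschmidt1988]
#3 SurplusNonneg (crux) — for ℚ-linearly independent z : Fin n → ℂ, trdeg ℚ(z₁, …, zₙ) + trdeg
ℚ(e^{z₁}, …, e^{zₙ}) ≥ n (surplus σ = a + b − n ≥ 0; sketch surplus-linkage-split X1: a = 0 face =
Lindemann–Weierstrass, proved; b = 0 face = algebraic independence of logarithms, open; mixed face =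
Gel'fond–Schneider–Diaz ladder territory). [difficulty: open-problem] (why it might fail: its b = 0
face is AIL itself (Barrier B1 horizon) and the mixed face at n ≥ 4 exceeds the
Gel'fond–Schneider–Philippon ceiling [(d+1)/2] (LNM 1752 Ch.14 Cor. 2.8) — true iff Schanuel, but
possibly not easier beyond n = 3.) [NesterenkoPhilippon2001, Diaz1989, Lang1966, Baker1975]
#4 NonlinearLinkage (crux) — RESIDUAL conjunct — for ℚ-linearly independent z with surplus ≥ 0
(SurplusNonneg at z) and at most b independent L-affine relations (BakerOverL at z), trdeg ℚ(z, e^z)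
≥ n; equivalently a failure of Schanuel at non-negative surplus cannot come from nonlinear algebraic
linkage between ℚ(z) and ℚ(e^z) alone. Provably empty for n ≤ 2 and for b = 0 (tower law); first
genuine instance n = 3, normal form (u, u², u³ + ℓ). [deps: SurplusNonneg, BakerOverL] [difficulty:
open-problem] (why it might fail: it is the imported complement of the attacked conjuncts: at n = 3,
b = 1 a transcendental u with e^u, e^{u²} algebraic over ℚ(e^{u³+ℓ}) is excluded by nothing known;
no method family owns nonlinear linkage (declared residual, exempt T3/T4).) [Lang1966, Ax1971,
Kirby2010]

TWO-LAYER PLAN. Foreseen glued splits (registered BC3 skeletons, nothing filed now): BakerOverL ⇐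
stub_homogeneous (d₀ + b ≥ n for span_L(z)) →
stub_inhomogeneous (1 ∈ span_L(z) ⇒ d₀ + b ≥ n + 1) → BakerOverL (glue proved:
rank_sup_add_rank_inf_eq); SurplusNonneg ⇐ stub_logLayer
(b = 0: AIL) → stub_lindemannLayer (a = 0: LW, provable now from `algebraicIndependent_exp`) →
stub_mixedLayer → SurplusNonneg (glue proved,
by_cases); NonlinearLinkage ⇐ stub_lowDim (n ≤ 2, provable) → stub_zeroDefect (b = 0, provable) →
stub_core (n ≥ 3, b ≥ 1) → NonlinearLinkage.

KILL CRITERIA. A tuple refuting BakerOverL (more than b independent L-affine relations) or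
SurplusNonneg refutes Schanuel itself (each is a consequence of
S: close `refuted:<Decl>` AND file the witness as ¬Schanuel). A proof that BakerOverL at b = 1
already implies AIL(n) for all n (i.e. that the
attacked conjunct is summit-hard by a cheap reduction) retires the split as a costume — pivot to the
b-graded ladder as a FRONTIER route.
AIL proved elsewhere moots stub_logLayer; Schanuel for n ≤ 3 proved elsewhere moots the first
residual instance.

NOT DECOMPOSED YET. The b-grading of BakerOverL beyond the registered two stubs (b = 1 with L ⊇ ℚ(π)
or ℚ(e) is the first real target: (1, iπ) ⇒ e ⊥ π,
(1, e) ⇒ e ⊥ e^e); zero estimates / interpolation determinants over L (Laurent) as the engine; the n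
= 3 normal form (u, u², u³ + ℓ) of the
residual; constants of any transcendence-measure-free Baker step. All layer-2, after a stub closes.

CHEAPEST FALSIFIER. Lookup + one page of algebra: does BakerOverL at level b = 1, n = 3 already
contain a statement printed as Schanuel-equivalent? Test tuples:
(1, iπ, log 2) [b = 0: Baker, fine], (1, e, e²)-type [LI fails], (log 2, √2·log 2, e)… if a refuter
exhibits a b = 1 instance of BakerOverL that is
literally AIL(3) or (e ⊥ π) ∧ AIL, the "attacked conjunct is easier family-wise" claim dies at its
first rung. Ran myself: b = 0 layer = tree
`baker_holds` (BakerOverL_rung', rc 0); n ≤ 2 residual empty (stub_lowDim provable); BC7 batteries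
CLEAN ×3.

NUMBERS. Ceilings the cruxes are measured against: Baker's method over a coefficient field K needs K
of transcendence type ≤ τ with MN ≥ (τ−1)(M+N)+N·r₂
(Chudnovsky1984 Ch. 2 §1, p. 138; trdeg K ≤ 1 in Thm 1.1/1.2); Gel'fond–Schneider–Diaz: t ≥
[dℓ/(ℓ+d)] under (T.H.), ladder [(d+1)/2]
(NesterenkoPhilippon2001 Ch. 14 Thm 2.7, Cor. 2.8; Diaz1989); small trdeg: Schanuel known for n = 1
(Hermite–Lindemann) and for no n ≥ 2.
Items at open: 4 (3 cruxes + assembly).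

DEFINITION REQUESTS. None: IntermediateField.adjoin, Algebra.trdeg, algebraicClosure (as
IntermediateField), Submodule.span, Module.rank are Mathlib; every
crux is a one-line Prop over them (Sketch.lean rc 0).

Novelty: Searches (2026-08-17): `lit vsearch "<SurplusNonneg in prose>" -k 10` (Baker1975 pp.111–116,
Chudnovsky1984, LNM 1752 pp.246–249 — no sum
form); `lit search --hybrid "Schanuel conjecture weaker statement transcendence degree of logarithms
plus … exponentials"` (10 books, none
states a + b ≥ n); `lit search --hybrid "Baker theorem linear forms logarithms coefficients
transcendental field"` → book:chudnovsky1984 p.138;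
`lit galaxy search "finite transcendence type|type de transcendance fini" --star all` (panama:
Chudnovsky 498379415093251, Waldschmidt LNM 402
338795610243078, Wüstholz LNM 1290 513334491218017; pdf/crabby 0); `lit galaxy search "algebraic
independence of logarithms|indépendance
algébrique de logarithmes" --star all` (9 panama textbooks, pdf: Waldschmidt hal-00405120, GL 326 =
pdf:3852319220); galaxy bm25 pdf
"transcendence degree of Q(x) plus … weak Schanuel" (10 model-theory hits, none relevant); `lit
frontier Schanuel --since 2020` (20 rows:
Zilber–Pink, p-adic, odd zeta, elliptic Schanuel property arXiv:2504.14041/14048 — nothing on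
L-affine rank or surplus); `lean search` /
BC4 `exact?` against all 46 Schanuel Theses: no existing item with these bodies.
Nearest prior art found: Chudnovsky1984 Ch. 2 Thm 1.1 (p. 138: Baker's method with coefficients in a
field of transcendence type ≤ τ) and
NesterenkoPhilippon2001 Ch. 14 Conj. 2.5 / Thm 2.7 (Baker-type "intermediate situation" conjecture;
Diaz under T.H.); in-tree nearest
routes DiophantineCore (BakerOnExpAlge  [refs: 2504.14041, book:chudnovsky1984, Baker1975, Chudnovsky1984, NesterenkoPhilippon2001]

Barriers (technique_class: baker-method, transc-coeff-field, gelfond-schneider, split): - technique_class: baker-method, transc-coeff-field, gelfond-schneider, split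
- Literature.Barriers.Schanuel.AlgebraicIndependenceOfLogarithms: NOT evaded on the b = 0 face of
SurplusNonneg (stub_logLayer IS AIL — conceded horizon, ranked 3 not 2); BakerOverL's b = 0 layer is
Baker's theorem (inside what the barrier grants), its b ≥ 1 layers quantify over tuples with
transcendental exponentials, outside the barrier's scope (AIL is about exp⁻¹(ℚ̄) only).
- Literature.Barriers.Schanuel.LinearSubgroupMethodLimit: Roy's limit (roy1995_thm_3_4) bounds what
LST-embeddings of the linear-subgroup theorem give toward AIL; BakerOverL at b ≥ 1 is not an AIL
statement and the route does not go through LST — but any proof of stub_logLayer by that method sits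
inside it (conceded).
- Literature.Barriers.Schanuel.LargeTranscendenceDegree: the mixed face of SurplusNonneg at n ≥ 4
asks more than [(d+1)/2] without (T.H.): inside the class; the bet is the T.H.-free zero estimate
already wanted by AlgIndepMethod (stmt-Schanuel-10491 LargeTrdegWithoutTH) — cited, not re-filed;
BakerOverL is a LINEAR-rank statement, outside the several-variables Gel'fond class.
- Literature.Barriers.Schanuel.EFunctionValuesAtAlgebraicPoints: the route never evaluates
E-functions at transcendental points; (e, π), (e, e^e) appear only as b = 1 instances of BakerOverL,
to be attacked by Baker's method over L, not Siegel–Shidlovskii.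
- Literature.Barriers.Schanuel.NesterenkoModularScope: not used; no modular input is c

sub-problem: Schanuel · status: open · opened planner-type-3e2e6de994-0 2026-08-17T18:09:30Z · rev 0 · ledger route-Schanuel-SurplusLinkage
GENERATED by the gate from the ledger (D-0016/17). Provers cite these decls: `theorem foo : Summit.Schanuel.Schanuel.Theses.SurplusLinkage.<Decl> := …` in Summits/Schanuel/Schanuel/Theorems/<Name>.lean.
-/

namespace Summit.Schanuel.Schanuel.Theses.SurplusLinkage

open scoped BigOperators Topology Manifold Classical MeasureTheory ProbabilityTheory Matrix InnerProductSpace ComplexConjugate ContinuousMap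
open Filter Set Function TopologicalSpace MeasureTheory

attribute [summit_statement] _root_.Schanuel

open Literature.Periods

/-- item stmt-Schanuel-18993 · crux · rank 2 · open · by planner
why it might fail: for b ≥ 1 Baker's method needs heights on the coefficient field; every printed extension (Chudnovsky1984 Ch.2, Waldschmidt transcendence type) assumes a transcendence MEASURE on L — height-free it may simply be Schanuel-hard at (e, π)-type tuples.
sources: Baker1975, Chudnovsky1984, NesterenkoPhilippon2001, Waldschmidt1988
[crux] for ℚ-linearly independent z : Fin n → ℂ, dim_L span_L(1, z₁, …, zₙ) + trdeg ℚ(e^z) ≥ n + 1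
with L = (algebraic closure of ℚ(e^z) in ℂ): the independent L-affine relations among 1, z₁, …, zₙ
number at most b (sketch baker-over-exponential-field X1; b = 0 layer = Baker's inhomogeneous
theorem). [difficulty: open-problem] -/
@[route_item "route-Schanuel-SurplusLinkage", crux]
def BakerOverL : Prop :=
  ∀ (n : ℕ) (z : Fin n → ℂ), LinearIndependent ℚ z → ((n + 1 : ℕ) : Cardinal) ≤ Module.rank ↥((algebraicClosure ↥(IntermediateField.adjoin ℚ (Set.range (Complex.exp ∘ z))) ℂ).restrictScalars ℚ) ↥(Submodule.span ↥((algebraicClosure ↥(IntermediateField.adjoin ℚ (Set.range (Complex.exp ∘ z))) ℂ).restrictScalars ℚ) (Set.range fun o : Option (Fin n) => o.elim (1 : ℂ) z)) + Algebra.trdeg ℚ ↥(IntermediateField.adjoin ℚ (Set.range (Complex.exp ∘ z)))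

/-- item stmt-Schanuel-18994 · crux · rank 3 · open · by planner
why it might fail: its b = 0 face is AIL itself (Barrier B1 horizon) and the mixed face at n ≥ 4 exceeds the Gel'fond–Schneider–Philippon ceiling [(d+1)/2] (LNM 1752 Ch.14 Cor. 2.8) — true iff Schanuel, but possibly not easier beyond n = 3.
sources: NesterenkoPhilippon2001, Diaz1989, Lang1966, Baker1975
[crux] for ℚ-linearly independent z : Fin n → ℂ, trdeg ℚ(z₁, …, zₙ) + trdeg ℚ(e^{z₁}, …, e^{zₙ}) ≥ n
(surplus σ = a + b − n ≥ 0; sketch surplus-linkage-split X1: a = 0 face = Lindemann–Weierstrass,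
proved; b = 0 face = algebraic independence of logarithms, open; mixed face =
Gel'fond–Schneider–Diaz ladder territory). [difficulty: open-problem] -/
@[route_item "route-Schanuel-SurplusLinkage", crux]
def SurplusNonneg : Prop :=
  ∀ (n : ℕ) (z : Fin n → ℂ), LinearIndependent ℚ z → (n : Cardinal) ≤ Algebra.trdeg ℚ ↥(IntermediateField.adjoin ℚ (Set.range z)) + Algebra.trdeg ℚ ↥(IntermediateField.adjoin ℚ (Set.range (Complex.exp ∘ z)))

/-- item stmt-Schanuel-18995 · crux · rank 4 · open · by planner
why it might fail: it is the imported complement of the attacked conjuncts: at n = 3, b = 1 a transcendental u with e^u, e^{u²} algebraic over ℚ(e^{u³+ℓ}) is excluded by nothing known; no method family owns nonlinear linkage (declared residual, exempt T3/T4).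
sources: Lang1966, Ax1971, Kirby2010
[crux] RESIDUAL conjunct — for ℚ-linearly independent z with surplus ≥ 0 (SurplusNonneg at z) and at
most b independent L-affine relations (BakerOverL at z), trdeg ℚ(z, e^z) ≥ n; equivalently a failure
of Schanuel at non-negative surplus cannot come from nonlinear algebraic linkage between ℚ(z) and
ℚ(e^z) alone. Provably empty for n ≤ 2 and for b = 0 (tower law); first genuine instance n = 3,
normal form (u, u², u³ + ℓ). [deps: SurplusNonneg, BakerOverL] [difficulty: open-problem] -/
@[route_item "route-Schanuel-SurplusLinkage", crux]
def NonlinearLinkage : Prop :=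
  ∀ (n : ℕ) (z : Fin n → ℂ), LinearIndependent ℚ z → (n : Cardinal) ≤ Algebra.trdeg ℚ ↥(IntermediateField.adjoin ℚ (Set.range z)) + Algebra.trdeg ℚ ↥(IntermediateField.adjoin ℚ (Set.range (Complex.exp ∘ z))) → ((n + 1 : ℕ) : Cardinal) ≤ Module.rank ↥((algebraicClosure ↥(IntermediateField.adjoin ℚ (Set.range (Complex.exp ∘ z))) ℂ).restrictScalars ℚ) ↥(Submodule.span ↥((algebraicClosure ↥(IntermediateField.adjoin ℚ (Set.range (Complex.exp ∘ z))) ℂ).restrictScalars ℚ) (Set.range fun o : Option (Fin n) => o.elim (1 : ℂ) z)) + Algebra.trdeg ℚ ↥(IntermediateField.adjoin ℚ (Set.range (Complex.exp ∘ z))) → (n : Cardinal) ≤ Algebra.trdeg ℚ ↥(IntermediateField.adjoin ℚ (Set.range z ∪ Set.range (Complex.exp ∘ z)))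

/-- item stmt-Schanuel-18996 · assembly · rank 1 · open · by planner
sources: Lang1966, Baker1975
[assembly] SurplusNonneg → BakerOverL → NonlinearLinkage → Schanuel. -/
@[route_item "route-Schanuel-SurplusLinkage"]
def Assembly : Prop :=
  SurplusNonneg → BakerOverL → NonlinearLinkage → _root_.Schanuel

/-! D-0027 §2.1 — DECIDING THEOREM (planner-authored via `route open/edit --closes-file`; by planner-type-3e2e6de994-0 2026-08-17T18:09:30Z):
its hypotheses are this route's items and its conclusion the sub-problem Statement (glue_lint), and it elaborates with this file. -/

@[closes "route-Schanuel-SurplusLinkage"] theorem closes (h₁ : SurplusNonneg) (h₂ : BakerOverL) (h₃ : NonlinearLinkage) : _root_.Schanuel :=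
  (id (α := Assembly) fun g₁ g₂ g₃ n z hz => g₃ n z hz (g₁ n z hz) (g₂ n z hz)) h₁ h₂ h₃

end Summit.Schanuel.Schanuel.Theses.SurplusLinkage
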